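import Mathlib
import Literature.Analysis.FunctionSpaces.MinlosSazonovBound
import Summits.RiemannHypothesis.RiemannHypothesis.Theorems.PfPersistenceF2SplitDeflation

/-!
# F2 / PURE PLANTS — frame (bottom-eigenvector) two-sided bounds for resolvent numbers (G-SPLIT-X kernel, part 2)

pub-rhpf fake seat 2, generation 6.  **Mechanism / rigidity campaign; no RH claims.**  Elementary, RH-free linear
algebra; companion of `PfPersistenceF2PlantCriterion`.  The plant threshold `η*(γ; w) = 1/(2√(m B̃))` involves the
resolvent numbers `A = pᵀQ⁻¹p`, `B = sᵀQ⁻¹s`, `C = pᵀQ⁻¹s` of ζ's window block `Q`.  The cell evaluates them from the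
`K` bottom eigenpairs `(E_k, v_k)` of `Q` (certified DATA) plus RIGOROUS TAIL BOUNDS; this file proves those bounds in
inverse-free form (preimages `Q y = x` instead of `Q⁻¹x`), over an arbitrary finite index type:

* `cross_decomp`: for an orthonormal eigen-frame `Q v_k = E_k v_k` (`E_k ≠ 0`) and preimages `Q y_p = p`, `Q y_s = s`,
  `⟨y_p, s⟩ = Σ_k ⟨v_k,p⟩⟨v_k,s⟩/E_k + ⟨y_p^⊥, Q y_s^⊥⟩` with `y^⊥ := y − Σ_k ⟨v_k,y⟩ v_k` (frame part + tail);
* `tail_form_le`: if `F|x|² ≤ xᵀQx` on the frame's orthogonal complement (`F > 0`; DATA: `F = E_K` when the frame is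
  the bottom of the spectrum) then `x^⊥ᵀ Q x^⊥ ≤ |Q x^⊥|²/F`, and `Q y^⊥ = x − Σ⟨v_k,x⟩v_k =: x^⊥_frame` (`mulVec_resid`)
  has the explicitly computable norm `|x|² − Σ_k⟨v_k,x⟩²` (`resid_normSq`);
* `preimage_value_bounds`: `Σ_k ⟨v_k,q⟩²/E_k ≤ ⟨y_q, q⟩ ≤ Σ_k ⟨v_k,q⟩²/E_k + (|q|² − Σ_k⟨v_k,q⟩²)/F`
  (the bounds `B'_K ≤ B' ≤ B'_K + t_s`, `A_K ≤ A ≤ A_K + t_p` of FAKES.md §2.10);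
* `cross_tail_sq_le`: `(⟨y_p,s⟩ − Σ_k⟨v_k,p⟩⟨v_k,s⟩/E_k)² ≤ t_p · t_s` (the bound `|C' − C'_K| ≤ √(t_p t_s)`).
Together with `PfPersistenceF2PlantCriterion.plant_threshold_iff` these make the two-sided threshold bracket
`η*_lo ≤ η* ≤ η*_up` of the cell a consequence of kernel-checked lemmas and certified window DATA.  All folklore
(Parseval / Cauchy–Schwarz / Temple-type tail bounds).
-/

namespace Summit.RiemannHypothesis.RiemannHypothesis.Theorems.PfPersistenceF2PlantFrame

open Matrix BigOperators Finset
open Literature.Analysis.FunctionSpaces.MinlosSazonov (sq_dotProduct_mulVec_le dotProduct_mulVec_comm)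
open Summit.RiemannHypothesis.RiemannHypothesis.Theorems.PfPersistenceF2SplitDeflation (form_nonneg)

variable {ι : Type*} [Fintype ι] {K : ℕ}

section Frame

variable {v : Fin K → ι → ℝ}

/-- Dot product against a linear combination of frame vectors. -/
theorem dotProduct_sum_smul (x : ι → ℝ) (c : Fin K → ℝ) (v : Fin K → ι → ℝ) :
    x ⬝ᵥ (∑ k, c k • v k) = ∑ k, c k * (x ⬝ᵥ v k) := by
  rw [dotProduct_sum]
  refine Finset.sum_congr rfl fun k _ => ?_
  rw [dotProduct_smul, smul_eq_mul]

/-- A linear combination of frame vectors dotted against a vector. -/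
theorem sum_smul_dotProduct (c : Fin K → ℝ) (v : Fin K → ι → ℝ) (x : ι → ℝ) :
    (∑ k, c k • v k) ⬝ᵥ x = ∑ k, c k * (v k ⬝ᵥ x) := by
  rw [sum_dotProduct]
  refine Finset.sum_congr rfl fun k _ => ?_
  rw [smul_dotProduct, smul_eq_mul]

/-- Orthonormal frame: the `j`-th coefficient of `Σ c_k v_k`. -/
theorem frame_coeff (hon : ∀ j k, v j ⬝ᵥ v k = if j = k then (1:ℝ) else 0) (c : Fin K → ℝ) (j : Fin K) :
    v j ⬝ᵥ (∑ k, c k • v k) = c j := by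
  rw [dotProduct_sum_smul]
  simp_rw [hon j]
  simp [mul_ite]

/-- The frame residual `x − Σ⟨v_k,x⟩v_k` is orthogonal to the frame. -/
theorem resid_orth (hon : ∀ j k, v j ⬝ᵥ v k = if j = k then (1:ℝ) else 0) (x : ι → ℝ) (j : Fin K) :
    v j ⬝ᵥ (x - ∑ k, (v k ⬝ᵥ x) • v k) = 0 := by
  rw [dotProduct_sub, frame_coeff hon]
  ring

/-- Parseval for the residual: `|x − Σ⟨v_k,x⟩v_k|² = |x|² − Σ⟨v_k,x⟩²`. -/
theorem resid_normSq (hon : ∀ j k, v j ⬝ᵥ v k = if j = k then (1:ℝ) else 0) (x : ι → ℝ) :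
    (x - ∑ k, (v k ⬝ᵥ x) • v k) ⬝ᵥ (x - ∑ k, (v k ⬝ᵥ x) • v k) = x ⬝ᵥ x - ∑ k, (v k ⬝ᵥ x) ^ 2 := by
  have h1 : (x - ∑ k, (v k ⬝ᵥ x) • v k) ⬝ᵥ (∑ k, (v k ⬝ᵥ x) • v k) = 0 := by
    rw [dotProduct_sum_smul]
    refine Finset.sum_eq_zero fun k _ => ?_
    rw [dotProduct_comm _ (v k), resid_orth hon x k, mul_zero]
  have h2 : (x - ∑ k, (v k ⬝ᵥ x) • v k) ⬝ᵥ x = x ⬝ᵥ x - ∑ k, (v k ⬝ᵥ x) ^ 2 := by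
    rw [sub_dotProduct, sum_smul_dotProduct]
    congr 1
    refine Finset.sum_congr rfl fun k _ => ?_
    ring
  rw [dotProduct_sub, h1, h2, sub_zero]

variable {Q : Matrix ι ι ℝ} {E : Fin K → ℝ}

/-- Frame coefficients of a preimage: `Q y = x`, `Q v_k = E_k v_k`, `Q` symmetric ⇒ `E_k ⟨v_k, y⟩ = ⟨v_k, x⟩`. -/
theorem coeff_preimage (hQ : Q.IsHermitian) (hev : ∀ k, Q *ᵥ v k = E k • v k) {y x : ι → ℝ}
    (hy : Q *ᵥ y = x) (k : Fin K) : E k * (v k ⬝ᵥ y) = v k ⬝ᵥ x := by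
  calc E k * (v k ⬝ᵥ y) = y ⬝ᵥ (E k • v k) := by rw [dotProduct_smul, smul_eq_mul, dotProduct_comm]
    _ = y ⬝ᵥ Q *ᵥ v k := by rw [hev]
    _ = v k ⬝ᵥ Q *ᵥ y := dotProduct_mulVec_comm hQ _ _
    _ = v k ⬝ᵥ x := by rw [hy]

/-- `Q` maps the frame residual of a preimage to the frame residual of its image:
`Q (y − Σ⟨v_k,y⟩v_k) = x − Σ⟨v_k,x⟩v_k`. -/
theorem mulVec_resid (hQ : Q.IsHermitian) (hev : ∀ k, Q *ᵥ v k = E k • v k) {y x : ι → ℝ}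
    (hy : Q *ᵥ y = x) :
    Q *ᵥ (y - ∑ k, (v k ⬝ᵥ y) • v k) = x - ∑ k, (v k ⬝ᵥ x) • v k := by
  rw [mulVec_sub, mulVec_sum, hy]
  congr 1
  refine Finset.sum_congr rfl fun k _ => ?_
  rw [mulVec_smul, hev, smul_smul, mul_comm, coeff_preimage hQ hev hy]

/-- **Frame + tail decomposition of a cross resolvent number.**  `Q y_p = p`, `Q y_s = s`, orthonormal eigen-frame
with `E_k ≠ 0`:  `⟨y_p, s⟩ = Σ_k ⟨v_k,p⟩⟨v_k,s⟩/E_k + ⟨y_p^⊥, Q y_s^⊥⟩`. [folklore] -/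
theorem cross_decomp (hQ : Q.IsHermitian) (hon : ∀ j k, v j ⬝ᵥ v k = if j = k then (1:ℝ) else 0)
    (hev : ∀ k, Q *ᵥ v k = E k • v k) (hE : ∀ k, E k ≠ 0) {y_p p y_s s : ι → ℝ}
    (hp : Q *ᵥ y_p = p) (hs : Q *ᵥ y_s = s) :
    y_p ⬝ᵥ s = ∑ k, (v k ⬝ᵥ p) * (v k ⬝ᵥ s) / E k
      + (y_p - ∑ k, (v k ⬝ᵥ y_p) • v k) ⬝ᵥ Q *ᵥ (y_s - ∑ k, (v k ⬝ᵥ y_s) • v k) := by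
  have hys := mulVec_resid hQ hev hs
  -- s = Q y_s^⊥ + Σ⟨v_k,s⟩v_k
  have hs_split : s = Q *ᵥ (y_s - ∑ k, (v k ⬝ᵥ y_s) • v k) + ∑ k, (v k ⬝ᵥ s) • v k := by
    rw [hys, sub_add_cancel]
  -- y_p = y_p^⊥ + Σ⟨v_k,y_p⟩v_k
  have hyp_split : y_p = (y_p - ∑ k, (v k ⬝ᵥ y_p) • v k) + ∑ k, (v k ⬝ᵥ y_p) • v k := by
    rw [sub_add_cancel]
  have hframe : (∑ k, (v k ⬝ᵥ y_p) • v k) ⬝ᵥ s = ∑ k, (v k ⬝ᵥ p) * (v k ⬝ᵥ s) / E k := by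
    rw [sum_smul_dotProduct]
    refine Finset.sum_congr rfl fun k _ => ?_
    have hc := coeff_preimage hQ hev hp k
    have hk := hE k
    rw [← hc]
    field_simp
  have htail : (y_p - ∑ k, (v k ⬝ᵥ y_p) • v k) ⬝ᵥ s
      = (y_p - ∑ k, (v k ⬝ᵥ y_p) • v k) ⬝ᵥ Q *ᵥ (y_s - ∑ k, (v k ⬝ᵥ y_s) • v k) := by
    conv_lhs => rw [hs_split]
    rw [dotProduct_add, dotProduct_sum_smul]
    have hz : ∑ k, (v k ⬝ᵥ s) * ((y_p - ∑ k, (v k ⬝ᵥ y_p) • v k) ⬝ᵥ v k) = 0 := by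
      refine Finset.sum_eq_zero fun k _ => ?_
      rw [dotProduct_comm _ (v k), resid_orth hon y_p k, mul_zero]
    rw [hz, add_zero]
  conv_lhs => rw [hyp_split]
  rw [add_dotProduct, htail, hframe]
  ring

variable {F : ℝ}

/-- **Tail bound from a complement floor.**  If `F|x|² ≤ xᵀQx` for every `x` orthogonal to the frame and `0 < F`,
then for such `x`: `xᵀQx ≤ |Qx|²/F` (Cauchy–Schwarz). [folklore] -/
theorem tail_form_le (hF : ∀ x : ι → ℝ, (∀ k, v k ⬝ᵥ x = 0) → F * (x ⬝ᵥ x) ≤ x ⬝ᵥ Q *ᵥ x) (hFpos : 0 < F)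
    {x : ι → ℝ} (hx : ∀ k, v k ⬝ᵥ x = 0) :
    x ⬝ᵥ Q *ᵥ x ≤ ((Q *ᵥ x) ⬝ᵥ (Q *ᵥ x)) / F := by
  have h1 := hF x hx
  have hxx : 0 ≤ x ⬝ᵥ x := by
    unfold dotProduct; exact Finset.sum_nonneg fun i _ => mul_self_nonneg (x i)
  have hΦ : 0 ≤ x ⬝ᵥ Q *ᵥ x := le_trans (mul_nonneg hFpos.le hxx) h1
  have hcs : (x ⬝ᵥ Q *ᵥ x) ^ 2 ≤ (x ⬝ᵥ x) * ((Q *ᵥ x) ⬝ᵥ (Q *ᵥ x)) := by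
    have h := Finset.sum_mul_sq_le_sq_mul_sq Finset.univ x (Q *ᵥ x)
    have e1 : x ⬝ᵥ x = ∑ i, x i ^ 2 := by
      unfold dotProduct; exact Finset.sum_congr rfl fun i _ => by ring
    have e2 : (Q *ᵥ x) ⬝ᵥ (Q *ᵥ x) = ∑ i, (Q *ᵥ x) i ^ 2 := by
      unfold dotProduct; exact Finset.sum_congr rfl fun i _ => by ring
    rw [e1, e2]
    exact h
  have hN : 0 ≤ (Q *ᵥ x) ⬝ᵥ (Q *ᵥ x) := by
    unfold dotProduct; exact Finset.sum_nonneg fun i _ => mul_self_nonneg _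
  rw [le_div_iff₀ hFpos]
  rcases eq_or_lt_of_le hΦ with h0 | hpos
  · rw [← h0, zero_mul]; exact hN
  · -- F Φ² ≤ F |x|² |Qx|² ≤ Φ |Qx|²  ⇒  F Φ ≤ |Qx|²
    have h2 : F * (x ⬝ᵥ Q *ᵥ x) ^ 2 ≤ (x ⬝ᵥ Q *ᵥ x) * ((Q *ᵥ x) ⬝ᵥ (Q *ᵥ x)) := by
      calc F * (x ⬝ᵥ Q *ᵥ x) ^ 2 ≤ F * ((x ⬝ᵥ x) * ((Q *ᵥ x) ⬝ᵥ (Q *ᵥ x))) :=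
            mul_le_mul_of_nonneg_left hcs hFpos.le
        _ = (F * (x ⬝ᵥ x)) * ((Q *ᵥ x) ⬝ᵥ (Q *ᵥ x)) := by ring
        _ ≤ (x ⬝ᵥ Q *ᵥ x) * ((Q *ᵥ x) ⬝ᵥ (Q *ᵥ x)) := mul_le_mul_of_nonneg_right h1 hN
    nlinarith

/-- **Two-sided frame bounds for a diagonal resolvent number** (`B'_K ≤ B' ≤ B'_K + t_s` of FAKES.md §2.10):
`Q ⪰ 0`, orthonormal eigen-frame with `E_k > 0`, complement floor `F > 0`, preimage `Q y = q`.  Then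
`Σ_k⟨v_k,q⟩²/E_k ≤ ⟨y,q⟩ ≤ Σ_k⟨v_k,q⟩²/E_k + (|q|² − Σ_k⟨v_k,q⟩²)/F`. [folklore] -/
theorem preimage_value_bounds (hQ : Q.PosSemidef) (hon : ∀ j k, v j ⬝ᵥ v k = if j = k then (1:ℝ) else 0)
    (hev : ∀ k, Q *ᵥ v k = E k • v k) (hE : ∀ k, 0 < E k)
    (hF : ∀ x : ι → ℝ, (∀ k, v k ⬝ᵥ x = 0) → F * (x ⬝ᵥ x) ≤ x ⬝ᵥ Q *ᵥ x) (hFpos : 0 < F)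
    {y q : ι → ℝ} (hy : Q *ᵥ y = q) :
    ∑ k, (v k ⬝ᵥ q) ^ 2 / E k ≤ y ⬝ᵥ q
      ∧ y ⬝ᵥ q ≤ ∑ k, (v k ⬝ᵥ q) ^ 2 / E k + (q ⬝ᵥ q - ∑ k, (v k ⬝ᵥ q) ^ 2) / F := by
  have hd := cross_decomp hQ.1 hon hev (fun k => (hE k).ne') hy hy
  have hsq : ∑ k, (v k ⬝ᵥ q) * (v k ⬝ᵥ q) / E k = ∑ k, (v k ⬝ᵥ q) ^ 2 / E k :=
    Finset.sum_congr rfl fun k _ => by ring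
  rw [hsq] at hd
  have hΦ := form_nonneg hQ (y - ∑ k, (v k ⬝ᵥ y) • v k)
  have horth : ∀ k, v k ⬝ᵥ (y - ∑ k, (v k ⬝ᵥ y) • v k) = 0 := resid_orth hon y
  have ht := tail_form_le hF hFpos horth
  have hr : (Q *ᵥ (y - ∑ k, (v k ⬝ᵥ y) • v k)) ⬝ᵥ (Q *ᵥ (y - ∑ k, (v k ⬝ᵥ y) • v k))
      = q ⬝ᵥ q - ∑ k, (v k ⬝ᵥ q) ^ 2 := by
    rw [mulVec_resid hQ.1 hev hy, resid_normSq hon q]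
  rw [hr] at ht
  constructor
  · linarith
  · linarith

/-- **Cross tail bound** (`|C' − C'_K| ≤ √(t_p t_s)` of FAKES.md §2.10): with two preimages `Q y_p = p`, `Q y_s = s`,
`(⟨y_p,s⟩ − Σ_k⟨v_k,p⟩⟨v_k,s⟩/E_k)² ≤ ((|p|² − Σ⟨v_k,p⟩²)/F) · ((|s|² − Σ⟨v_k,s⟩²)/F)`. [folklore] -/
theorem cross_tail_sq_le (hQ : Q.PosSemidef) (hon : ∀ j k, v j ⬝ᵥ v k = if j = k then (1:ℝ) else 0)
    (hev : ∀ k, Q *ᵥ v k = E k • v k) (hE : ∀ k, 0 < E k)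
    (hF : ∀ x : ι → ℝ, (∀ k, v k ⬝ᵥ x = 0) → F * (x ⬝ᵥ x) ≤ x ⬝ᵥ Q *ᵥ x) (hFpos : 0 < F)
    {y_p p y_s s : ι → ℝ} (hp : Q *ᵥ y_p = p) (hs : Q *ᵥ y_s = s) :
    (y_p ⬝ᵥ s - ∑ k, (v k ⬝ᵥ p) * (v k ⬝ᵥ s) / E k) ^ 2
      ≤ ((p ⬝ᵥ p - ∑ k, (v k ⬝ᵥ p) ^ 2) / F) * ((s ⬝ᵥ s - ∑ k, (v k ⬝ᵥ s) ^ 2) / F) := by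
  have hd := cross_decomp hQ.1 hon hev (fun k => (hE k).ne') hp hs
  have e : y_p ⬝ᵥ s - ∑ k, (v k ⬝ᵥ p) * (v k ⬝ᵥ s) / E k
      = (y_p - ∑ k, (v k ⬝ᵥ y_p) • v k) ⬝ᵥ Q *ᵥ (y_s - ∑ k, (v k ⬝ᵥ y_s) • v k) := by
    rw [hd]; ring
  rw [e]
  have hcs := sq_dotProduct_mulVec_le hQ (y_p - ∑ k, (v k ⬝ᵥ y_p) • v k) (y_s - ∑ k, (v k ⬝ᵥ y_s) • v k)
  have htp := tail_form_le hF hFpos (resid_orth hon y_p)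
  have hts := tail_form_le hF hFpos (resid_orth hon y_s)
  have hrp : (Q *ᵥ (y_p - ∑ k, (v k ⬝ᵥ y_p) • v k)) ⬝ᵥ (Q *ᵥ (y_p - ∑ k, (v k ⬝ᵥ y_p) • v k))
      = p ⬝ᵥ p - ∑ k, (v k ⬝ᵥ p) ^ 2 := by
    rw [mulVec_resid hQ.1 hev hp, resid_normSq hon p]
  have hrs : (Q *ᵥ (y_s - ∑ k, (v k ⬝ᵥ y_s) • v k)) ⬝ᵥ (Q *ᵥ (y_s - ∑ k, (v k ⬝ᵥ y_s) • v k))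
      = s ⬝ᵥ s - ∑ k, (v k ⬝ᵥ s) ^ 2 := by
    rw [mulVec_resid hQ.1 hev hs, resid_normSq hon s]
  rw [hrp] at htp
  rw [hrs] at hts
  have h1 := form_nonneg hQ (y_p - ∑ k, (v k ⬝ᵥ y_p) • v k)
  have h2 := form_nonneg hQ (y_s - ∑ k, (v k ⬝ᵥ y_s) • v k)
  calc _ ≤ _ := hcs
    _ ≤ _ := mul_le_mul htp hts h2 (le_trans h1 htp)

end Frame

section Bracket

/-- **Monotonicity of the effective coupling** `B̃ = B − 4mC²/(1+4mA)`: it is increasing in `B` and `A` and decreasing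
in `C²`; hence frame-plus-tail upper bounds `A ≤ A⁺`, `B ≤ B⁺` and a lower bound `c² ≤ C²` give
`B̃ ≤ B⁺ − 4m c²/(1+4mA⁺)` (the `B̃_up` of FAKES.md §2.10). [folklore] -/
theorem coupling_upper_mono {m A A' B B' C c : ℝ} (hm : 0 ≤ m) (h0 : 0 < 1 + 4 * m * A)
    (hA : A ≤ A') (hB : B ≤ B') (hc : c ^ 2 ≤ C ^ 2) :
    B - 4 * m * C ^ 2 / (1 + 4 * m * A) ≤ B' - 4 * m * c ^ 2 / (1 + 4 * m * A') := by
  have h0' : 0 < 1 + 4 * m * A' := by nlinarith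
  have h1 : c ^ 2 / (1 + 4 * m * A') ≤ C ^ 2 / (1 + 4 * m * A) := by
    rw [div_le_div_iff₀ h0' h0]
    have : c ^ 2 * (1 + 4 * m * A) ≤ C ^ 2 * (1 + 4 * m * A) :=
      mul_le_mul_of_nonneg_right hc h0.le
    nlinarith [sq_nonneg C, mul_nonneg hm (sq_nonneg C)]
  have h2 : 4 * m * (c ^ 2 / (1 + 4 * m * A')) ≤ 4 * m * (C ^ 2 / (1 + 4 * m * A)) :=
    mul_le_mul_of_nonneg_left h1 (by linarith)
  rw [mul_div_assoc, mul_div_assoc]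
  linarith

/-- The clipped frame value is a lower bound for `|C|`: `|C − C_K| ≤ δ ⇒ (max (|C_K| − δ) 0)² ≤ C²`. -/
theorem sq_clip_le_sq {C C_K δ : ℝ} (h : |C - C_K| ≤ δ) : (max (|C_K| - δ) 0) ^ 2 ≤ C ^ 2 := by
  rcases le_or_gt (|C_K| - δ) 0 with hle | hlt
  · rw [max_eq_right hle]
    simpa using sq_nonneg C
  · rw [max_eq_left hlt.le]
    have h1 : |C_K| - δ ≤ |C| := by
      have := abs_sub_abs_le_abs_sub C_K C
      rw [abs_sub_comm] at this
      linarith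
    have h2 : 0 ≤ |C_K| - δ := hlt.le
    calc (|C_K| - δ) ^ 2 ≤ |C| ^ 2 := by
          exact pow_le_pow_left₀ h2 h1 2
      _ = C ^ 2 := sq_abs C

-- (`|x| ≤ δ` from `x² ≤ δ²`, `0 ≤ δ` is Mathlib's `abs_le_of_sq_le_sq`; with `δ² = t_p t_s` it turns
-- `cross_tail_sq_le` into the `|C' − C'_K| ≤ √(t_p t_s)` form used by the cell.)

end Bracket

end Summit.RiemannHypothesis.RiemannHypothesis.Theorems.PfPersistenceF2PlantFrame
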